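import Literature.Geometry.Riemannian.GurskyViaclovskyClosednessLimit
import HarnessLib

/-!
# Gursky–Viaclovsky closedness: covariant `C²` bounds give uniform `C²` bounds of the chart
# representatives

Support file (everything PROVED; no definition, no named fact) for the named fact
`Literature.Geometry.Riemannian.gurskyViaclovsky_pathClosed_weighted_four`. The hypothesis of
the fact bounds the solutions covariantly: `|u| ≤ C`, `|∇u|²_g ≤ C`, `|∇²u|²_g ≤ C`. The elliptic
estimates of the printed proof (Evans–Krylov, Schauder) and the Arzelà–Ascoli extraction of
`GurskyViaclovskyClosednessExtraction.lean` are run on the chart representatives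
`U = u ∘ (chartAt c)⁻¹`; this file supplies the dictionary between the two kinds of bounds:

* `opNorm_le_of_frame`, `opNorm₂_le_of_frame` — a continuous (bi)linear map is bounded by its
  values on a `G₀`-orthonormal frame, with the constant `‖G₀‖ κ` (`κ` a bound for the frame
  vectors) coming from the expansion `v = Σ_a G₀(v, e_a) e_a`;
* `chart_c2_bounds` — for the preferred chart at any point `c` of a manifold modelled on `ℝ⁴`
  carrying a Riemannian metric `g` with its Levi-Civita connection there are `r > 0` with
  `B̄(chartAt c c, r) ⊆ (chartAt c).target` and a constant `A ≥ 0` such that every smooth `u` with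
  `|u| ≤ C`, `|∇u|²_g ≤ C`, `|∇²u|²_g ≤ C` on `M` has `|U| ≤ C`, `‖DU‖ ≤ A √C`, `‖D²U‖ ≤ A √C` on
  the ball (`U = u ∘ (chartAt c)⁻¹`): in the chart the covariant Hessian is
  `H_{ij} = ∂_i∂_jU − Γ^k_{ij} ∂_kU` (O'Neill 1983, Lemma 3.49, tree: `OpensChart.hessian_eq` for
  the metric pulled back along the inverse chart), a `g`-orthonormal frame at the image point is
  a `G(y)`-orthonormal frame of the model space, the frame entries of `dU`, `Hess U` are bounded by
  `√C` (`sq_mvfderiv_frame_le_gradSq`, `sq_apply_frame_le_normSq`), and the metric coefficients,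
  their uniform positivity and the Christoffel symbols are bounded on the compact ball;
* `chart_iteratedFDeriv_bounds_le_two` — the same for a family `u_k`, phrased as uniform bounds on
  `‖iteratedFDeriv ℝ m U_k‖`, `m ≤ 2`, on the ball: the orders `≤ 2` of the hypothesis `hbounds`
  of `pathClosed_of_chartSmoothBounds` (Extraction file) thus follow from the fact's own
  hypotheses, and only the orders `≥ 3` — the Evans–Krylov + Schauder a priori estimates proper —
  remain to be supplied.

## References

* M. J. Gursky, J. A. Viaclovsky, J. Differential Geom. 63 (2003) 131–154, Prop. 6, §5.
  [GurskyViaclovsky2003]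
* B. O'Neill, *Semi-Riemannian Geometry* (1983), Ch. 3, Lemma 49. [ONeill1983]
-/

noncomputable section

open scoped Manifold ContDiff Topology
open Set Filter Metric Function Module

namespace Literature.Geometry.Riemannian.GurskyViaclovskyPath

open Literature.Geometry.Lorentzian (PseudoRiemannianMetric)
open Literature.Geometry.Lorentzian.PseudoRiemannianMetric
open Literature.Geometry.Lorentzian

/-! ### Frame algebra on a normed space -/

section FrameAlgebra

variable {E : Type*} [NormedAddCommGroup E] [NormedSpace ℝ E]
  {F : Type*} [NormedAddCommGroup F] [NormedSpace ℝ F]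

/-- **A continuous linear map is bounded by its values on a frame.** If every vector expands as
`v = Σ_a G₀(v, e_a) e_a` (e.g. `e` a `G₀`-orthonormal basis), `‖G₀‖ ≤ Λ` and `‖e_a‖ ≤ κ`, then
`‖L‖ ≤ Λ κ Σ_a ‖L e_a‖`. [folklore] -/
theorem opNorm_le_of_frame {ι : Type*} [Fintype ι] (G₀ : E →L[ℝ] E →L[ℝ] ℝ) (e : ι → E)
    (hexp : ∀ v, ∑ a, G₀ v (e a) • e a = v) {Λ κ : ℝ} (hΛ : ‖G₀‖ ≤ Λ) (hκ : ∀ a, ‖e a‖ ≤ κ)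
    (hκ0 : 0 ≤ κ) (L : E →L[ℝ] F) : ‖L‖ ≤ Λ * κ * ∑ a, ‖L (e a)‖ := by
  have hΛ0 : 0 ≤ Λ := (norm_nonneg G₀).trans hΛ
  refine ContinuousLinearMap.opNorm_le_bound _ (by positivity) fun v ↦ ?_
  have hcoef : ∀ a, |G₀ v (e a)| ≤ Λ * κ * ‖v‖ := fun a ↦ by
    calc |G₀ v (e a)| = ‖G₀ v (e a)‖ := (Real.norm_eq_abs _).symm
      _ ≤ ‖G₀ v‖ * ‖e a‖ := (G₀ v).le_opNorm _
      _ ≤ ‖G₀‖ * ‖v‖ * ‖e a‖ := mul_le_mul_of_nonneg_right (G₀.le_opNorm v) (norm_nonneg _)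
      _ ≤ Λ * ‖v‖ * κ := mul_le_mul (mul_le_mul_of_nonneg_right hΛ (norm_nonneg _)) (hκ a)
          (norm_nonneg _) (by positivity)
      _ = Λ * κ * ‖v‖ := by ring
  calc ‖L v‖ = ‖∑ a, G₀ v (e a) • L (e a)‖ := by
        conv_lhs => rw [← hexp v]
        simp only [map_sum, map_smul]
    _ ≤ ∑ a, ‖G₀ v (e a) • L (e a)‖ := norm_sum_le _ _
    _ = ∑ a, |G₀ v (e a)| * ‖L (e a)‖ := by simp only [norm_smul, Real.norm_eq_abs]
    _ ≤ ∑ a, Λ * κ * ‖v‖ * ‖L (e a)‖ :=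
        Finset.sum_le_sum fun a _ ↦ mul_le_mul_of_nonneg_right (hcoef a) (norm_nonneg _)
    _ = Λ * κ * (∑ a, ‖L (e a)‖) * ‖v‖ := by rw [Finset.mul_sum, Finset.sum_mul]; ring_nf

/-- The bilinear version: `‖B‖ ≤ (Λκ)² Σ_{a,b} |B(e_a, e_b)|`. [folklore] -/
theorem opNorm₂_le_of_frame {ι : Type*} [Fintype ι] (G₀ : E →L[ℝ] E →L[ℝ] ℝ) (e : ι → E)
    (hexp : ∀ v, ∑ a, G₀ v (e a) • e a = v) {Λ κ : ℝ} (hΛ : ‖G₀‖ ≤ Λ) (hκ : ∀ a, ‖e a‖ ≤ κ)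
    (hκ0 : 0 ≤ κ) (B : E →L[ℝ] E →L[ℝ] ℝ) :
    ‖B‖ ≤ (Λ * κ) ^ 2 * ∑ a, ∑ b, |B (e a) (e b)| := by
  have hΛ0 : 0 ≤ Λ := (norm_nonneg G₀).trans hΛ
  have h1 := opNorm_le_of_frame G₀ e hexp hΛ hκ hκ0 B
  have h2 : ∀ a, ‖B (e a)‖ ≤ Λ * κ * ∑ b, |B (e a) (e b)| := fun a ↦ by
    have h := opNorm_le_of_frame G₀ e hexp hΛ hκ hκ0 (B (e a))
    simpa only [Real.norm_eq_abs] using h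
  calc ‖B‖ ≤ Λ * κ * ∑ a, ‖B (e a)‖ := h1
    _ ≤ Λ * κ * ∑ a, Λ * κ * ∑ b, |B (e a) (e b)| :=
        mul_le_mul_of_nonneg_left (Finset.sum_le_sum fun a _ ↦ h2 a) (by positivity)
    _ = (Λ * κ) ^ 2 * ∑ a, ∑ b, |B (e a) (e b)| := by rw [← Finset.mul_sum]; ring

/-- **Expansion in a `G₀`-orthonormal frame**: if `G₀(e_a, e_b) = δ_{ab}` and the frame has as
many vectors as the dimension, then `v = Σ_a G₀(v, e_a) e_a` (the frame is a basis; pair with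
`G₀(·, e_b)`). [folklore] -/
theorem sum_smul_frame_eq [FiniteDimensional ℝ E] {m : ℕ} (hm : finrank ℝ E = m)
    (G₀ : E →L[ℝ] E →L[ℝ] ℝ) (e : Fin m → E)
    (hon : ∀ a b, G₀ (e a) (e b) = if a = b then 1 else 0) (v : E) :
    ∑ a, G₀ v (e a) • e a = v := by
  classical
  -- linear independence by pairing with `G₀(·, e_b)`
  have hli : LinearIndependent ℝ e := by
    rw [Fintype.linearIndependent_iff]
    intro c hc b
    have h := congrArg (G₀.flip (e b)) hc
    rw [map_sum, map_zero] at h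
    simp only [map_smul, ContinuousLinearMap.flip_apply, smul_eq_mul, hon, mul_ite, mul_one,
      mul_zero, Finset.sum_ite_eq', Finset.mem_univ, if_true] at h
    exact h
  have hcard : Fintype.card (Fin m) = finrank ℝ E := by rw [Fintype.card_fin, hm]
  let b : Basis (Fin m) ℝ E := Basis.mk hli (hli.span_eq_top_of_card_eq_finrank' hcard).ge
  have hb : ∀ a, b a = e a := fun a ↦ Basis.mk_apply hli _ a
  -- coefficients of `v` in the basis are `G₀(v, e_a)`
  have hrepr : ∀ a, b.repr v a = G₀ v (e a) := by
    intro a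
    have hv : v = ∑ k, b.repr v k • e k := by
      conv_lhs => rw [← b.sum_repr v]
      simp only [hb]
    have h2 : G₀ v (e a) = G₀.flip (e a) v := rfl
    rw [h2]
    conv_rhs => rw [hv, map_sum]
    simp only [map_smul, ContinuousLinearMap.flip_apply, smul_eq_mul, hon, mul_ite, mul_one,
      mul_zero, Finset.sum_ite_eq', Finset.mem_univ, if_true]
  calc ∑ a, G₀ v (e a) • e a = ∑ a, b.repr v a • b a := by simp only [hrepr, hb]
    _ = v := b.sum_repr v

/-- A `G₀`-unit vector has norm at most `λ^{-1/2}` when `λ‖v‖² ≤ G₀(v,v)`. [folklore] -/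
theorem norm_le_sqrt_inv_of_unit (G₀ : E →L[ℝ] E →L[ℝ] ℝ) {lam : ℝ} (hlam : 0 < lam)
    (hpos : ∀ v, lam * ‖v‖ ^ 2 ≤ G₀ v v) {v : E} (hv : G₀ v v = 1) :
    ‖v‖ ≤ Real.sqrt lam⁻¹ := by
  have h := hpos v
  rw [hv] at h
  have h1 : ‖v‖ ^ 2 ≤ lam⁻¹ := by
    calc ‖v‖ ^ 2 = lam⁻¹ * (lam * ‖v‖ ^ 2) := by field_simp
      _ ≤ lam⁻¹ * 1 := mul_le_mul_of_nonneg_left h (by positivity)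
      _ = lam⁻¹ := mul_one _
  calc ‖v‖ = Real.sqrt (‖v‖ ^ 2) := (Real.sqrt_sq (norm_nonneg _)).symm
    _ ≤ Real.sqrt lam⁻¹ := Real.sqrt_le_sqrt h1

end FrameAlgebra

/-! ### Uniform `C²` bounds of the chart representatives -/

section ChartBounds

variable {M : Type*} [TopologicalSpace M] [ChartedSpace (EuclideanSpace ℝ (Fin 4)) M]
  [IsManifold (𝓡 4) ∞ M]
  (g : PseudoRiemannianMetric (𝓡 4) ∞ (EuclideanSpace ℝ (Fin 4)) (TangentSpace (𝓡 4) : M → Type _))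
  [g.HasLeviCivita]

/-- Scaling of a bilinear form on a line: `G₀(t v, t v) = t² G₀(v, v)`. [folklore] -/
theorem bilin_smul_smul {E : Type*} [NormedAddCommGroup E] [NormedSpace ℝ E]
    (G₀ : E →L[ℝ] E →L[ℝ] ℝ) (t : ℝ) (v : E) : G₀ (t • v) (t • v) = t ^ 2 * G₀ v v := by
  have h1 : G₀ (t • v) = t • G₀ v := G₀.map_smul t v
  rw [h1]
  change t • (G₀ v (t • v)) = _
  rw [map_smul, smul_eq_mul, smul_eq_mul]
  ring
set_option maxHeartbeats 400000 in -- buildfix (bf3-g26): 160k/180k FAIL, 200k PASS at accept time; line-neutral budget line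
/-- **Covariant `C²` bounds give chart `C²` bounds.** For the preferred chart at a point `c` of a
manifold modelled on `ℝ⁴` with a Riemannian metric `g` (Levi-Civita connection) there are a radius
`r > 0` with `B̄(chartAt c c, r) ⊆ (chartAt c).target` and a constant `A ≥ 0`, depending only on
`g` and the chart, such that for every smooth `u : M → ℝ` with `|∇u|²_g ≤ C` and `|∇²u|²_g ≤ C`
on `M` the representative `U = u ∘ (chartAt c)⁻¹` satisfies `‖DU(y)‖ ≤ A √C` and
`‖D²U(y)‖ ≤ A √C` on the closed ball. In the chart `Hess_g u = D²U − Γ·DU` (O'Neill 1983,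
Lemma 3.49); a `g`-orthonormal frame at the image point is a `G(y)`-orthonormal frame of `ℝ⁴`
whose vectors have length `≤ λ^{-1/2}` (`λ` the uniform positivity constant of the coefficients
`G` on the compact ball), the frame entries of `dU` and `Hess_g u` are at most `√C`
(`sq_mvfderiv_frame_le_gradSq`, `sq_apply_frame_le_normSq`), and `‖G‖`, `‖Γ‖` are bounded on the
ball. [cite: ONeill1983, Ch. 3, Lemma 3.49] -/
theorem chart_c2_bounds (hg : g.IsRiemannian) (c : M) :
    ∃ r : ℝ, 0 < r ∧
      closedBall (chartAt (EuclideanSpace ℝ (Fin 4)) c c) r ⊆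
        (chartAt (EuclideanSpace ℝ (Fin 4)) c).target ∧
      ∃ A : ℝ, 0 ≤ A ∧ ∀ (u : M → ℝ), ContMDiff (𝓡 4) 𝓘(ℝ) ∞ u → ∀ C : ℝ,
        (∀ x, g.gradSq u x ≤ C ∧ g.normSq x (g.hessian u x) ≤ C) →
        ∀ y ∈ closedBall (chartAt (EuclideanSpace ℝ (Fin 4)) c c) r,
          ‖fderiv ℝ (fun z ↦ u ((chartAt (EuclideanSpace ℝ (Fin 4)) c).symm z)) y‖
              ≤ A * Real.sqrt C ∧
          ‖fderiv ℝ (fderiv ℝ (fun z ↦ u ((chartAt (EuclideanSpace ℝ (Fin 4)) c).symm z))) y‖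
              ≤ A * Real.sqrt C := by
  classical
  -- the inverse chart at `c` and the pulled-back metric (as in the chart-transport lemmas)
  set U : TopologicalSpace.Opens (EuclideanSpace ℝ (Fin 4)) :=
    ⟨(chartAt (EuclideanSpace ℝ (Fin 4)) c).target,
      (chartAt (EuclideanSpace ℝ (Fin 4)) c).open_target⟩ with hU
  set Φ : U → M := fun u ↦ (chartAt (EuclideanSpace ℝ (Fin 4)) c).symm u with hΦdef
  have hΦ : ContMDiff 𝓘(ℝ, EuclideanSpace ℝ (Fin 4)) 𝓘(ℝ, EuclideanSpace ℝ (Fin 4)) (∞ + 1) Φ :=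
    ChartInverseSelf.contMDiff_symm c
  have hΦ' : ∀ u, Function.Injective
      (mfderiv 𝓘(ℝ, EuclideanSpace ℝ (Fin 4)) 𝓘(ℝ, EuclideanSpace ℝ (Fin 4)) Φ u) :=
    ChartInverseSelf.injective_mfderiv_symm c
  have hdim : Module.finrank ℝ (EuclideanSpace ℝ (Fin 4)) =
      Module.finrank ℝ (EuclideanSpace ℝ (Fin 4)) := rfl
  have hE : finrank ℝ (EuclideanSpace ℝ (Fin 4)) = 4 := finrank_euclideanSpace_fin
  have hpb : contMDiff_pullbackBilin 𝓘(ℝ, EuclideanSpace ℝ (Fin 4)) M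
      𝓘(ℝ, EuclideanSpace ℝ (Fin 4)) U ∞ := contMDiff_pullbackBilin_holds
  set gU := g.comap hpb Φ hΦ hΦ' hdim with hgU
  haveI : gU.HasLeviCivita := gU.hasLeviCivita
  set G : EuclideanSpace ℝ (Fin 4) →
      EuclideanSpace ℝ (Fin 4) →L[ℝ] EuclideanSpace ℝ (Fin 4) →L[ℝ] ℝ :=
    Function.extend (Subtype.val : U → EuclideanSpace ℝ (Fin 4))
      (fun y : U ↦ (gU.val y :
        EuclideanSpace ℝ (Fin 4) →L[ℝ] EuclideanSpace ℝ (Fin 4) →L[ℝ] ℝ)) (fun _ ↦ 0) with hGdef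
  have hG : ∀ y : U, gU.val y = G y := fun y ↦ by
    rw [hGdef, Subtype.val_injective.extend_apply]
  have hmet : MetricCoord.IsMetricOn G (U : Set (EuclideanSpace ℝ (Fin 4))) :=
    OpensChart.isMetricOn_repr hG
  -- `G y (v, w) = g (dΦ v, dΦ w)` and positivity
  have hGval : ∀ (y : U) (v w : EuclideanSpace ℝ (Fin 4)), G y v w =
      g.val (Φ y) (mfderiv 𝓘(ℝ, EuclideanSpace ℝ (Fin 4)) 𝓘(ℝ, EuclideanSpace ℝ (Fin 4)) Φ y v)
        (mfderiv 𝓘(ℝ, EuclideanSpace ℝ (Fin 4)) 𝓘(ℝ, EuclideanSpace ℝ (Fin 4)) Φ y w) := by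
    intro y v w
    rw [← hG]
    rfl
  have hGpos : ∀ (y : U) (v : EuclideanSpace ℝ (Fin 4)), v ≠ 0 → 0 < G y v v := by
    intro y v hv
    rw [hGval]
    refine hg _ _ fun h0 ↦ hv ((hΦ' y) ?_)
    rw [h0]
    exact ((mfderiv 𝓘(ℝ, EuclideanSpace ℝ (Fin 4)) 𝓘(ℝ, EuclideanSpace ℝ (Fin 4)) Φ y).map_zero).symm
  -- a closed ball inside the chart target
  set yc : EuclideanSpace ℝ (Fin 4) := chartAt (EuclideanSpace ℝ (Fin 4)) c c with hyc
  have hycT : yc ∈ (chartAt (EuclideanSpace ℝ (Fin 4)) c).target :=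
    (chartAt (EuclideanSpace ℝ (Fin 4)) c).map_source (mem_chart_source _ c)
  obtain ⟨r₀, hr₀, hr₀T⟩ := Metric.isOpen_iff.1 (chartAt (EuclideanSpace ℝ (Fin 4)) c).open_target
    yc hycT
  set r : ℝ := r₀ / 2 with hr
  have hrpos : 0 < r := half_pos hr₀
  have hK : closedBall yc r ⊆ (chartAt (EuclideanSpace ℝ (Fin 4)) c).target :=
    (closedBall_subset_ball (half_lt_self hr₀)).trans hr₀T
  have hKc := isCompact_closedBall yc r
  -- bounds for the metric coefficients and the Christoffel symbols on the ball
  have hGcont := hmet.contDiffOn.continuousOn.mono hK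
  have hΓcont := hmet.contDiffOn_chrAt.continuousOn.mono hK
  obtain ⟨Λ, hΛ⟩ := hKc.exists_bound_of_continuousOn
    (E := EuclideanSpace ℝ (Fin 4) →L[ℝ] EuclideanSpace ℝ (Fin 4) →L[ℝ] ℝ) hGcont
  obtain ⟨Γ₀, hΓ₀⟩ := hKc.exists_bound_of_continuousOn
    (E := EuclideanSpace ℝ (Fin 4) →L[ℝ] EuclideanSpace ℝ (Fin 4) →L[ℝ] EuclideanSpace ℝ (Fin 4))
    hΓcont
  have hΛ0 : 0 ≤ Λ := (norm_nonneg _).trans (hΛ yc (mem_closedBall_self hrpos.le))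
  have hΓ00 : 0 ≤ Γ₀ := (norm_nonneg _).trans (hΓ₀ yc (mem_closedBall_self hrpos.le))
  -- uniform positivity on the ball: the minimum of `G y (v, v)` over the ball × unit sphere
  set f : EuclideanSpace ℝ (Fin 4) × EuclideanSpace ℝ (Fin 4) → ℝ := fun p ↦ G p.1 p.2 p.2
    with hf
  have hS : IsCompact (closedBall yc r ×ˢ sphere (0 : EuclideanSpace ℝ (Fin 4)) 1) :=
    hKc.prod (isCompact_sphere 0 1)
  have hSne : (closedBall yc r ×ˢ sphere (0 : EuclideanSpace ℝ (Fin 4)) 1).Nonempty :=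
    ⟨(yc, EuclideanSpace.single 0 1), mem_closedBall_self hrpos.le, by simp⟩
  have hfc : ContinuousOn f (closedBall yc r ×ˢ sphere (0 : EuclideanSpace ℝ (Fin 4)) 1) := by
    have h1 := hGcont.comp continuous_fst.continuousOn
      fun p (hp : p ∈ closedBall yc r ×ˢ sphere (0 : EuclideanSpace ℝ (Fin 4)) 1) ↦ hp.1
    exact (h1.clm_apply continuous_snd.continuousOn).clm_apply continuous_snd.continuousOn
  obtain ⟨p₀, hp₀, hmin⟩ := hS.exists_isMinOn hSne hfc
  set lam : ℝ := f p₀ with hlam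
  have hlam0 : 0 < lam := by
    have hv0 : p₀.2 ≠ 0 := by
      intro h0
      have h := hp₀.2
      rw [mem_sphere_zero_iff_norm, h0, norm_zero] at h
      exact zero_ne_one h
    exact hGpos ⟨p₀.1, hK hp₀.1⟩ p₀.2 hv0
  have hposK : ∀ y ∈ closedBall yc r, ∀ v : EuclideanSpace ℝ (Fin 4),
      lam * ‖v‖ ^ 2 ≤ G y v v := by
    intro y hy v
    by_cases hv : v = 0
    · simp [hv]
    · have hn : 0 < ‖v‖ := norm_pos_iff.2 hv
      set w : EuclideanSpace ℝ (Fin 4) := ‖v‖⁻¹ • v with hw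
      have hws : w ∈ sphere (0 : EuclideanSpace ℝ (Fin 4)) 1 := by
        rw [mem_sphere_zero_iff_norm, hw, norm_smul, norm_inv, norm_norm, inv_mul_cancel₀ hn.ne']
      have hmin' : lam ≤ G y w w := isMinOn_iff.1 hmin (y, w) ⟨hy, hws⟩
      have hvw : v = ‖v‖ • w := by
        rw [hw, smul_smul, mul_inv_cancel₀ hn.ne', one_smul]
      calc lam * ‖v‖ ^ 2 ≤ G y w w * ‖v‖ ^ 2 :=
            mul_le_mul_of_nonneg_right hmin' (by positivity)
        _ = G y v v := by
            conv_rhs => rw [hvw, bilin_smul_smul (G y) ‖v‖ w]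
            ring
  -- the constant
  set κ : ℝ := Real.sqrt lam⁻¹ with hκ
  have hκ0 : 0 ≤ κ := Real.sqrt_nonneg _
  set A : ℝ := 4 * (Λ * κ) + 16 * (Λ * κ) ^ 2 * (1 + 4 * (Λ * κ) * (Γ₀ * κ ^ 2)) with hA
  have hA0 : 0 ≤ A := by positivity
  refine ⟨r, hrpos, hK, A, hA0, fun u hu C hbd y hy ↦ ?_⟩
  -- the point, a `g`-orthonormal frame at its image, and the corresponding frame of `ℝ⁴`
  set y' : U := ⟨y, hK hy⟩ with hy'
  obtain ⟨bM, hbM⟩ := g.exists_basis_isOrthonormalFrame (x := Φ y') (fun v hv ↦ hg _ v hv) hE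
  set eqv := mfderivEquivOfInjective (I := 𝓘(ℝ, EuclideanSpace ℝ (Fin 4)))
    (I' := 𝓘(ℝ, EuclideanSpace ℝ (Fin 4))) Φ y' (hΦ' y') hdim with heqv
  set e : Fin 4 → EuclideanSpace ℝ (Fin 4) := fun a ↦ eqv.symm (bM a) with he
  have hde : ∀ a, mfderiv 𝓘(ℝ, EuclideanSpace ℝ (Fin 4)) 𝓘(ℝ, EuclideanSpace ℝ (Fin 4)) Φ y'
      (e a) = bM a := fun a ↦ mfderiv_mfderivEquivOfInjective_symm _ _ _ _ _
  have hon : ∀ a b, G y (e a) (e b) = if a = b then 1 else 0 := by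
    intro a b
    have h := hGval y' (e a) (e b)
    rw [hde, hde] at h
    rw [show (y : EuclideanSpace ℝ (Fin 4)) = (y' : EuclideanSpace ℝ (Fin 4)) from rfl, h]
    by_cases hab : a = b
    · subst hab; simp [hbM.1 a]
    · simp [hab, hbM.2 a b hab]
  have hexp : ∀ v, ∑ a, G y v (e a) • e a = v := sum_smul_frame_eq hE (G y) e hon
  have hΛy : ‖G y‖ ≤ Λ := hΛ y hy
  have hκe : ∀ a, ‖e a‖ ≤ κ := fun a ↦
    norm_le_sqrt_inv_of_unit (G y) hlam0 (hposK y hy) (by rw [hon]; simp)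
  -- smoothness data
  set Urep : EuclideanSpace ℝ (Fin 4) → ℝ :=
    fun z ↦ u ((chartAt (EuclideanSpace ℝ (Fin 4)) c).symm z) with hUrep
  have h2top : (2 : WithTop ℕ∞) ≤ ∞ := WithTop.coe_le_coe.mpr le_top
  have hU2 : ContDiffAt ℝ 2 Urep y :=
    (ChartInverseSelf.contDiffAt_comp_symm c hu (hK hy)).of_le h2top
  have hGy : DifferentiableAt ℝ G y' := OpensChart.differentiableAt_repr hG y'
  have hrep : ∀ z : U, (u ∘ Φ) z = Urep z := fun z ↦ rfl
  have h2 : (2 : ℕ∞ω) ≤ ∞ := WithTop.coe_le_coe.mpr le_top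
  have hu2 : ContMDiffAt (𝓡 4) 𝓘(ℝ) 2 u (Φ y') := (hu.of_le h2) _
  have hud : MDifferentiableAt (𝓡 4) 𝓘(ℝ, ℝ) u (Φ y') := hu2.mdifferentiableAt (by simp)
  have hΦd : MDifferentiableAt 𝓘(ℝ, EuclideanSpace ℝ (Fin 4)) 𝓘(ℝ, EuclideanSpace ℝ (Fin 4))
      Φ y' := ((hΦ.of_le le_self_add) y').mdifferentiableAt (by simp)
  -- (A1) frame entries of `dU`
  have hD1e : ∀ a, fderiv ℝ Urep y (e a) = mvfderiv (𝓡 4) u (Φ y') (bM a) := by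
    intro a
    rw [← hde, ← mvfderiv_comp_apply hud hΦd,
      OpensChart.mvfderiv_eq y' (u ∘ Φ) _ hrep (hU2.differentiableAt (by norm_num))]
  have hD1e_le : ∀ a, ‖fderiv ℝ Urep y (e a)‖ ≤ Real.sqrt C := by
    intro a
    rw [hD1e, Real.norm_eq_abs]
    exact Real.abs_le_sqrt ((sq_mvfderiv_frame_le_gradSq g u hbM a).trans (hbd _).1)
  have hD1 : ‖fderiv ℝ Urep y‖ ≤ 4 * (Λ * κ) * Real.sqrt C := by
    calc ‖fderiv ℝ Urep y‖ ≤ Λ * κ * ∑ a, ‖fderiv ℝ Urep y (e a)‖ :=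
          opNorm_le_of_frame (G y) e hexp hΛy hκe hκ0 _
      _ ≤ Λ * κ * ∑ _a : Fin 4, Real.sqrt C :=
          mul_le_mul_of_nonneg_left (Finset.sum_le_sum fun a _ ↦ hD1e_le a) (by positivity)
      _ = 4 * (Λ * κ) * Real.sqrt C := by simp; ring
  -- (A2) frame entries of `D²U`: `D²U(e_a, e_b) = Hess_g u(ẽ_a, ẽ_b) + DU(Γ(e_b, e_a))`
  have hHess : ∀ a b, fderiv ℝ (fderiv ℝ Urep) y (e a) (e b) =
      g.hessian u (Φ y') (bM a) (bM b) +
        fderiv ℝ Urep y (OpensChart.christoffel gU G y' (e b) (e a)) := by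
    intro a b
    have h1 : g.hessian u (Φ y') (bM a) (bM b) = gU.hessian (u ∘ Φ) y' (e a) (e b) := by
      rw [← hde, ← hde]
      exact (g.hessian_comap_apply hpb hΦ hΦ' hdim hu2 (e a) (e b)).symm
    have hH : gU.hessian (u ∘ Φ) y' = OpensChart.hessianForm gU G Urep y' :=
      OpensChart.hessian_eq hG y' hGy hrep hU2
    have h4 : gU.hessian (u ∘ Φ) y' (e a) (e b) = fderiv ℝ (fderiv ℝ Urep) y (e a) (e b) -
        fderiv ℝ Urep y (OpensChart.christoffel gU G y' (e b) (e a)) := by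
      rw [hH]
      rfl
    rw [h1, h4]
    ring
  have hHe_le : ∀ a b, |g.hessian u (Φ y') (bM a) (bM b)| ≤ Real.sqrt C := fun a b ↦
    Real.abs_le_sqrt ((sq_apply_frame_le_normSq g hbM (g.hessian u (Φ y')) a b).trans (hbd _).2)
  have hΓe : ∀ a b, ‖OpensChart.christoffel gU G y' (e b) (e a)‖ ≤ Γ₀ * κ ^ 2 := by
    intro a b
    rw [OpensChart.christoffel_eq_chrAt hG y' (e a) (e b)]
    calc ‖MetricCoord.chrAt G y' (e a) (e b)‖ ≤ ‖MetricCoord.chrAt G y'‖ * ‖e a‖ * ‖e b‖ :=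
          (MetricCoord.chrAt G y').le_opNorm₂ (e a) (e b)
      _ ≤ Γ₀ * κ * κ := by
          refine mul_le_mul (mul_le_mul (hΓ₀ y hy) (hκe a) (norm_nonneg _) hΓ00) (hκe b)
            (norm_nonneg _) (by positivity)
      _ = Γ₀ * κ ^ 2 := by ring
  have hD2e_le : ∀ a b, |fderiv ℝ (fderiv ℝ Urep) y (e a) (e b)| ≤
      Real.sqrt C + 4 * (Λ * κ) * Real.sqrt C * (Γ₀ * κ ^ 2) := by
    intro a b
    rw [hHess]
    refine (abs_add_le _ _).trans (add_le_add (hHe_le a b) ?_)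
    rw [← Real.norm_eq_abs]
    calc ‖fderiv ℝ Urep y (OpensChart.christoffel gU G y' (e b) (e a))‖
        ≤ ‖fderiv ℝ Urep y‖ * ‖OpensChart.christoffel gU G y' (e b) (e a)‖ :=
          (fderiv ℝ Urep y).le_opNorm _
      _ ≤ 4 * (Λ * κ) * Real.sqrt C * (Γ₀ * κ ^ 2) :=
          mul_le_mul hD1 (hΓe a b) (norm_nonneg _) (by positivity)
  have hD2 : ‖fderiv ℝ (fderiv ℝ Urep) y‖ ≤
      16 * (Λ * κ) ^ 2 * (1 + 4 * (Λ * κ) * (Γ₀ * κ ^ 2)) * Real.sqrt C := by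
    calc ‖fderiv ℝ (fderiv ℝ Urep) y‖
        ≤ (Λ * κ) ^ 2 * ∑ a, ∑ b, |fderiv ℝ (fderiv ℝ Urep) y (e a) (e b)| :=
          opNorm₂_le_of_frame (G y) e hexp hΛy hκe hκ0 _
      _ ≤ (Λ * κ) ^ 2 * ∑ _a : Fin 4, ∑ _b : Fin 4,
            (Real.sqrt C + 4 * (Λ * κ) * Real.sqrt C * (Γ₀ * κ ^ 2)) :=
          mul_le_mul_of_nonneg_left
            (Finset.sum_le_sum fun a _ ↦ Finset.sum_le_sum fun b _ ↦ hD2e_le a b) (by positivity)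
      _ = 16 * (Λ * κ) ^ 2 * (1 + 4 * (Λ * κ) * (Γ₀ * κ ^ 2)) * Real.sqrt C := by simp; ring
  have hC0 : 0 ≤ Real.sqrt C := Real.sqrt_nonneg C
  constructor
  · calc ‖fderiv ℝ Urep y‖ ≤ 4 * (Λ * κ) * Real.sqrt C := hD1
      _ ≤ A * Real.sqrt C :=
          mul_le_mul_of_nonneg_right (le_add_of_nonneg_right (by positivity)) hC0
  · calc ‖fderiv ℝ (fderiv ℝ Urep) y‖
        ≤ 16 * (Λ * κ) ^ 2 * (1 + 4 * (Λ * κ) * (Γ₀ * κ ^ 2)) * Real.sqrt C := hD2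
      _ ≤ A * Real.sqrt C :=
          mul_le_mul_of_nonneg_right (le_add_of_nonneg_left (by positivity)) hC0

/-- **Orders `≤ 2` of the uniform chart bounds** (`hbounds` of `pathClosed_of_chartSmoothBounds`,
Extraction file) **follow from the fact's covariant bounds**: for a family `u_k` of smooth
functions with `|u_k| ≤ C`, `|∇u_k|²_g ≤ C`, `|∇²u_k|²_g ≤ C`, around every point `c` there is a
chart ball on which `‖Dᵐ(u_k ∘ (chartAt c)⁻¹)‖`, `m ≤ 2`, are bounded uniformly in `k`.
[cite: ONeill1983, Ch. 3, Lemma 3.49] -/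
theorem chart_iteratedFDeriv_bounds_le_two (hg : g.IsRiemannian) {u : ℕ → M → ℝ}
    (hu : ∀ k, ContMDiff (𝓡 4) 𝓘(ℝ) ∞ (u k)) {C : ℝ}
    (hbd : ∀ k x, |u k x| ≤ C ∧ g.gradSq (u k) x ≤ C ∧ g.normSq x (g.hessian (u k) x) ≤ C)
    (c : M) :
    ∃ r : ℝ, 0 < r ∧
      ball (chartAt (EuclideanSpace ℝ (Fin 4)) c c) r ⊆
        (chartAt (EuclideanSpace ℝ (Fin 4)) c).target ∧
      ∀ m ≤ 2, ∃ B : ℝ, ∀ k, ∀ y ∈ ball (chartAt (EuclideanSpace ℝ (Fin 4)) c c) r,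
        ‖iteratedFDeriv ℝ m (fun z ↦ u k ((chartAt (EuclideanSpace ℝ (Fin 4)) c).symm z)) y‖
          ≤ B := by
  obtain ⟨r, hr, hK, A, -, hb⟩ := chart_c2_bounds g hg c
  refine ⟨r, hr, ball_subset_closedBall.trans hK, fun m hm ↦ ?_⟩
  have hb' : ∀ k, ∀ y ∈ ball (chartAt (EuclideanSpace ℝ (Fin 4)) c c) r,
      ‖fderiv ℝ (fun z ↦ u k ((chartAt (EuclideanSpace ℝ (Fin 4)) c).symm z)) y‖
          ≤ A * Real.sqrt C ∧
        ‖fderiv ℝ (fderiv ℝ (fun z ↦ u k ((chartAt (EuclideanSpace ℝ (Fin 4)) c).symm z))) y‖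
          ≤ A * Real.sqrt C := fun k y hy ↦
    hb (u k) (hu k) C (fun x ↦ (hbd k x).2) y (ball_subset_closedBall hy)
  interval_cases m
  · refine ⟨C, fun k y _ ↦ ?_⟩
    rw [norm_iteratedFDeriv_zero, Real.norm_eq_abs]
    exact (hbd k _).1
  · refine ⟨A * Real.sqrt C, fun k y hy ↦ ?_⟩
    rw [← norm_iteratedFDeriv_fderiv, norm_iteratedFDeriv_zero]
    exact (hb' k y hy).1
  · refine ⟨A * Real.sqrt C, fun k y hy ↦ ?_⟩
    rw [← norm_iteratedFDeriv_fderiv, ← norm_iteratedFDeriv_fderiv, norm_iteratedFDeriv_zero]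
    exact (hb' k y hy).2

end ChartBounds

end Literature.Geometry.Riemannian.GurskyViaclovskyPath

end
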